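import Mathlib.Algebra.BigOperators.Fin
import Mathlib.Analysis.SpecialFunctions.Log.Base
import Mathlib.Data.Fin.Tuple.Basic
import Literature.Computability.Complexity.PEASigmaTwoProgram
import HarnessLib

/-!
# Entropy approximation in `Σ₂ᵖ`, II: renaming, mean log-fibre size, Chebyshev on sample tuples

Second file of the proof of `PEA d ∈ promiseLift (SigmaP 2)` (program and notation:
`PEASigmaTwoProgram.lean`).  Pure combinatorics of the renamed map `Q = rename p` on
`n' = nVars p` Boolean variables:

* `eval_eq_map_evalV` — the sparse map `p : F₂ⁿ → F₂^m` evaluated at `x` is the renamed map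
  evaluated at the bits of `x` on the used variables; `entropy_eq_mapEntropy_rename` — hence the
  output entropies agree (the restriction `x ↦ x ∘ ι` along the injective enumeration `ι` of the used
  variables has fibres of equal size, `mapEntropy_univ_comp_restrict`), and `entropy_le_nVars`;
* `sum_logb_card_fib` — the mean of `log₂ |fibre|` over the domain is `n' - H`;
* `sum_sq_sum_eq` — for a centred `φ`, `Σ_{Y ∈ αᵀ} (Σᵢ φ(Yᵢ))² = T |α|^{T-1} Σ_a φ(a)²` (variance of
  an i.i.d. sum), and the Chebyshev count `card_filter_devi_le`: at most `|α|ᵀ · (Σ_a φ² /|α|) · T / θ²`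
  tuples have `|Σᵢ φ(Yᵢ)| ≥ θ`;
* `card_far_logfib_le` — with `T = 128 n'²` samples, at most an eighth of the tuples
  `Y ∈ (F₂^{n'})^T` have `|Σᵢ log₂|fibre(Yᵢ)| - T(n' - H)| ≥ T/4`.

## References

* Z. Dvir, D. Gutfreund, G. N. Rothblum, S. Vadhan, ECCC TR10-160 (2010), §2–3.
* T. Cover, J. Thomas, *Elements of Information Theory*, 2nd ed., Thm 2.6.6, §3.1 (AEP by Chebyshev).
* M. Sipser, STOC 1983, §V.
-/

namespace Literature.Computability.Complexity

open _root_.Computability Finset Blocks SipserHash Literature.InformationTheory.Entropy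

namespace PEAHash

/-! ### Booleans versus `ZMod 2` -/

/-- The bit of an element of `ZMod 2`… as used throughout: `toZ b = [b]`. We write the coercion
explicitly as an `if`. [folklore] -/
theorem zmod2_eq_zero_or_one : ∀ z : ZMod 2, z = 0 ∨ z = 1 := by
  decide

/-- `(if a ^^ b then 1 else 0) = (if a …) + (if b …)` in `ZMod 2`. [folklore] -/
theorem ite_xor_eq_add (a b : Bool) :
    (if (a ^^ b) then (1 : ZMod 2) else 0) = (if a then 1 else 0) + (if b then 1 else 0) := by
  cases a <;> cases b <;> decide

/-- An xor-fold is a sum in `ZMod 2`. [folklore] -/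
theorem ite_foldl_xor_eq_sum {γ : Type*} (f : γ → Bool) (l : List γ) (b : Bool) :
    (if l.foldl (fun acc c => (acc ^^ f c)) b then (1 : ZMod 2) else 0) =
      (if b then 1 else 0) + (l.map fun c => if f c then (1 : ZMod 2) else 0).sum := by
  induction l generalizing b with
  | nil => simp
  | cons c l ih =>
    rw [List.foldl_cons, ih, ite_xor_eq_add, List.map_cons, List.sum_cons, add_assoc]

/-- A product of elements of `ZMod 2` is `1` iff all factors are `1`, as an `all`. [folklore] -/
theorem prod_map_eq_ite_all {γ : Type*} (x : γ → ZMod 2) (μ : List γ) :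
    (μ.map x).prod = if μ.all (fun i => decide (x i = 1)) then 1 else 0 := by
  induction μ with
  | nil => simp
  | cons i μ ih =>
    rw [List.map_cons, List.prod_cons, ih, List.all_cons]
    rcases zmod2_eq_zero_or_one (x i) with h | h <;> simp [h]

/-! ### The used variables and the renaming -/

section Renaming

variable (I : PEAInst)

/-- Every index occurring in the erased map is below the declared number of variables. [folklore] -/
theorem lt_of_mem_usedVars {i : ℕ} (hi : i ∈ usedVars (erase I).2.1) : i < I.1 := by
  unfold usedVars erase at hi
  simp only [List.mem_dedup, List.mem_flatten, List.mem_map] at hi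
  obtain ⟨l₁, ⟨l₂, ⟨p, -, rfl⟩, hl₁⟩, hi⟩ := hi
  obtain ⟨μ, -, rfl⟩ := List.mem_map.1 hl₁
  obtain ⟨j, -, rfl⟩ := List.mem_map.1 hi
  exact j.isLt

/-- The used variables are listed without repetition. [folklore] -/
theorem nodup_usedVars (P : List (List (List ℕ))) : (usedVars P).Nodup := List.nodup_dedup _

/-- An index of a monomial of the map is a used variable. [folklore] -/
theorem val_mem_usedVars {p : List (List (Fin I.1))} (hp : p ∈ I.2.1) {μ : List (Fin I.1)} (hμ : μ ∈ p)
    {j : Fin I.1} (hj : j ∈ μ) : j.val ∈ usedVars (erase I).2.1 := by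
  unfold usedVars erase
  simp only [List.mem_dedup, List.mem_flatten, List.mem_map]
  exact ⟨μ.map Fin.val, ⟨p.map (List.map Fin.val), ⟨p, hp, rfl⟩, List.mem_map.2 ⟨μ, hμ, rfl⟩⟩,
    List.mem_map.2 ⟨j, hj, rfl⟩⟩

/-- **The enumeration `ι` of the used variables**: position `j < n'` ↦ the `j`-th used variable. [folklore] -/
def usedEmb (j : Fin (nVars (erase I).2.1)) : Fin I.1 :=
  ⟨(usedVars (erase I).2.1)[j.val]'j.isLt, lt_of_mem_usedVars I (List.getElem_mem _)⟩

/-- `ι` is injective (the list has no duplicates). [folklore] -/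
theorem usedEmb_injective : Function.Injective (usedEmb I) := by
  intro a b h
  have h' := congrArg Fin.val h
  simp only [usedEmb] at h'
  exact Fin.ext ((nodup_usedVars _).getElem_inj_iff.1 h')

/-- The renamed position of a used variable points back to it: `ι (idxOf j) = j`. [folklore] -/
theorem usedEmb_idxOf {j : Fin I.1} (hj : j.val ∈ usedVars (erase I).2.1) :
    usedEmb I ⟨(usedVars (erase I).2.1).idxOf j.val, List.idxOf_lt_length_of_mem hj⟩ = j := by
  apply Fin.ext
  simp only [usedEmb]
  exact List.getElem_idxOf _

/-- The bits of a point of `F₂ⁿ` on the used variables, in their enumeration. [folklore] -/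
def usedBits (x : Fin I.1 → ZMod 2) : Fin (nVars (erase I).2.1) → Bool :=
  fun j => decide (x (usedEmb I j) = 1)

/-- One output polynomial: if the bits `xs` read through the index map `r` are the bits of `x`
on the variables of `p`, then `p(x) = [evalPoly xs (renamed p)]` in `ZMod 2`. [folklore] -/
theorem sum_prod_eq_ite_evalPoly {n : ℕ} (p : List (List (Fin n))) (x : Fin n → ZMod 2) (r : ℕ → ℕ)
    (xs : List Bool) (hxs : ∀ μ ∈ p, ∀ j ∈ μ, xs.getD (r j.val) false = decide (x j = 1)) :
    (p.map fun μ => (μ.map x).prod).sum =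
      if evalPoly xs ((p.map (List.map Fin.val)).map (List.map r)) then 1 else 0 := by
  rw [evalPoly, ite_foldl_xor_eq_sum, if_neg (by decide), zero_add, List.map_map, List.map_map]
  congr 1
  apply List.map_congr_left
  intro μ hμ
  simp only [Function.comp_apply, prod_map_eq_ite_all, evalMono, List.map_map, List.all_map]
  have hall : (μ.all fun i => decide (x i = 1)) = μ.all ((fun i => xs.getD i false) ∘ r ∘ Fin.val) := by
    apply Bool.eq_iff_iff.2
    simp only [List.all_eq_true, Function.comp_apply]
    exact forall₂_congr fun j hj => by rw [hxs μ hμ j hj]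
  rw [hall]

/-- **Evaluation is evaluation of the renamed map on the used bits**: output `i` of `p(x)` is `1`
iff bit `i` of `Q(usedBits x)` is set. [cite: DvirGutfreundRothblumVadhan2010, §3 p.6] -/
theorem eval_eq_map_evalV (x : Fin I.1 → ZMod 2) :
    PolyMapF2.eval I.2.1 x =
      (evalV (rename (erase I).2.1) (nVars (erase I).2.1) (usedBits I x)).map
        fun b => if b then 1 else 0 := by
  set xs := List.ofFn (usedBits I x) with hxs
  set r : ℕ → ℕ := fun i => (usedVars (erase I).2.1).idxOf i with hr
  show I.2.1.map (fun p => (p.map fun μ => (μ.map x).prod).sum) =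
    (((I.2.1.map (List.map (List.map Fin.val))).map (List.map (List.map r))).map (evalPoly xs)).map
      fun b => if b then 1 else 0
  simp only [List.map_map]
  apply List.map_congr_left
  intro p hp
  show (p.map fun μ => (μ.map x).prod).sum =
    if evalPoly xs ((p.map (List.map Fin.val)).map (List.map r)) then 1 else 0
  refine sum_prod_eq_ite_evalPoly p x r xs fun μ hμ j hj => ?_
  have hmem := val_mem_usedVars I hp hμ hj
  have hlt : r j.val < nVars (erase I).2.1 := List.idxOf_lt_length_of_mem hmem
  rw [hxs, List.getD_eq_getElem _ _ (by simpa using hlt), List.getElem_ofFn]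
  simp only [usedBits]
  rw [show (⟨r j.val, by simpa using hlt⟩ : Fin (nVars (erase I).2.1)) = ⟨r j.val, hlt⟩ from rfl,
    usedEmb_idxOf I hmem]

end Renaming

/-! ### Entropy is invariant under restriction to the used variables -/

section Restrict

variable {A A' R β : Type*} [Fintype A] [Fintype A'] [DecidableEq A] [DecidableEq A']
  [Fintype R] [DecidableEq R] [DecidableEq β]

/-- Entropy ignores an independent uniform coordinate: `H(g(U) ) = H((g ∘ fst)(U × U'))`. [folklore] -/
theorem mapEntropy_univ_comp_fst {α γ : Type*} [Fintype α] [Fintype γ] [Nonempty γ] [DecidableEq γ]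
    (g : α → β) : mapEntropy (univ : Finset (α × γ)) (fun q => g q.1) = mapEntropy univ g := by
  classical
  rcases isEmpty_or_nonempty α with hα | hα
  · simp [mapEntropy]
  have hinj : mapEntropy (univ : Finset (α × γ)) (Prod.map g (fun _ : γ => (0 : ℕ))) =
      mapEntropy (univ : Finset (α × γ)) (fun q => g q.1) := by
    have : Prod.map g (fun _ : γ => (0 : ℕ)) = (fun y : β => (y, (0 : ℕ))) ∘ fun q : α × γ => g q.1 := by
      funext q; rfl
    rw [this]
    exact mapEntropy_comp_of_injOn _ _ fun a _ b _ h => (Prod.mk.injEq _ _ _ _ ▸ h :).1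
  rw [← hinj, ← univ_product_univ, mapEntropy_product univ_nonempty univ_nonempty, mapEntropy_const,
    add_zero]

/-- **Restriction along an injection does not change output entropy**: for `ι : A' → A` injective
and any `g` on `A' → R`, the map `x ↦ g (x ∘ ι)` on a uniform `x : A → R` has the entropy of `g` on a
uniform input (the coordinates off the range of `ι` are independent and unused). [folklore] -/
theorem mapEntropy_univ_comp_restrict [Nonempty R] {ι : A' → A} (hι : Function.Injective ι) (g : (A' → R) → β) :
    mapEntropy (univ : Finset (A → R)) (fun x => g (x ∘ ι)) = mapEntropy univ g := by
  classical
  -- `A ≃ A' ⊕ C` with `C` the complement of the range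
  let C : Type _ := ((Set.range ι)ᶜ : Set A)
  let e₁ : A ≃ A' ⊕ C :=
    (Equiv.Set.sumCompl (Set.range ι)).symm.trans (Equiv.sumCongr (Equiv.ofInjective ι hι).symm (Equiv.refl _))
  -- functions on `A` are pairs of functions
  let E : (A → R) ≃ (A' → R) × (C → R) :=
    (Equiv.arrowCongr e₁ (Equiv.refl R)).trans (Equiv.sumArrowEquivProdArrow A' C R)
  have hE : ∀ x : A → R, (E x).1 = x ∘ ι := by
    intro x
    funext a
    simp only [E, e₁, Equiv.trans_apply, Equiv.sumArrowEquivProdArrow_apply_fst, Function.comp_apply,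
      Equiv.arrowCongr_apply, Equiv.refl_apply, Equiv.symm_trans_apply, Equiv.sumCongr_symm,
      Equiv.sumCongr_apply, Equiv.symm_symm, Sum.map_inl, Equiv.refl_symm]
    rw [Equiv.Set.sumCompl_apply_inl]
    rfl
  have h1 : (fun x : A → R => g (x ∘ ι)) = (fun q : (A' → R) × (C → R) => g q.1) ∘ E := by
    funext x; simp [hE]
  rw [h1]
  have h2 := mapEntropy_univ_comp_equiv E.symm ((fun q : (A' → R) × (C → R) => g q.1) ∘ E)
  rw [show ((fun q : (A' → R) × (C → R) => g q.1) ∘ E) ∘ E.symm = fun q => g q.1 by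
    funext q; simp] at h2
  rw [← h2]
  exact mapEntropy_univ_comp_fst g

end Restrict

section EntropyRename

variable (I : PEAInst)

/-- **The output entropy of the instance is the output entropy of the renamed map on the used bits.**
[cite: DvirGutfreundRothblumVadhan2010, §3 p.6] -/
theorem entropy_eq_mapEntropy_rename :
    PolyMapF2.entropy I.2.1 =
      mapEntropy univ (evalV (rename (erase I).2.1) (nVars (erase I).2.1)) := by
  classical
  set Q := rename (erase I).2.1
  set n' := nVars (erase I).2.1
  -- strip the injective postprocessing `List.map toZ`
  have h1 : PolyMapF2.entropy I.2.1 =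
      mapEntropy univ (fun x : Fin I.1 → ZMod 2 => evalV Q n' (usedBits I x)) := by
    unfold PolyMapF2.entropy
    have : PolyMapF2.eval I.2.1 =
        (List.map fun b : Bool => if b then (1 : ZMod 2) else 0) ∘ fun x => evalV Q n' (usedBits I x) := by
      funext x; exact eval_eq_map_evalV I x
    rw [this]
    refine mapEntropy_comp_of_injOn _ _ fun a _ b _ h => ?_
    exact List.map_injective_iff.2 (fun c d hcd => by cases c <;> cases d <;> simp_all) h
  -- `usedBits = β ∘ (· ∘ ι)` with `β` the bijection `ZMod 2 → Bool` coordinatewise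
  let βe : (Fin n' → ZMod 2) ≃ (Fin n' → Bool) :=
    Equiv.arrowCongr (Equiv.refl _) ⟨fun z => decide (z = 1), fun b => if b then 1 else 0,
      fun z => by rcases zmod2_eq_zero_or_one z with h | h <;> simp [h],
      fun b => by cases b <;> simp⟩
  have h2 : (fun x : Fin I.1 → ZMod 2 => evalV Q n' (usedBits I x)) =
      fun x => (evalV Q n' ∘ βe) (x ∘ usedEmb I) := by
    funext x; rfl
  rw [h1, h2, mapEntropy_univ_comp_restrict (usedEmb_injective I) (evalV Q n' ∘ βe)]
  have h3 := mapEntropy_univ_comp_equiv βe.symm (evalV Q n' ∘ βe)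
  rw [show (evalV Q n' ∘ βe) ∘ βe.symm = evalV Q n' by funext z; simp] at h3
  exact h3.symm

/-- The output entropy is at most the number of used variables. [cite: DvirGutfreundRothblumVadhan2010, Claim 2.2] -/
theorem entropy_le_nVars : PolyMapF2.entropy I.2.1 ≤ nVars (erase I).2.1 := by
  rw [entropy_eq_mapEntropy_rename]
  refine (mapEntropy_le_logb_card _ _).trans ?_
  rw [card_univ, Fintype.card_fun, Fintype.card_bool, Fintype.card_fin, Nat.cast_pow, Nat.cast_ofNat,
    Real.logb_pow, Real.logb_self_eq_one (by norm_num), mul_one]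

end EntropyRename

/-! ### The mean of `log₂ |fibre|` -/

section Mean

variable (Q : List (List (List ℕ))) (n' : ℕ)

/-- Our fibres are the library's `fiber univ (evalV Q n')` (definitional). [folklore] -/
theorem fib_eq_fiber (x : Fin n' → Bool) : fib Q n' x = fiber univ (evalV Q n') (evalV Q n' x) := rfl

/-- A fibre contains its base point, so it is nonempty. [folklore] -/
theorem card_fib_pos (x : Fin n' → Bool) : 0 < (fib Q n' x).card :=
  card_pos.2 ⟨x, by simp [fib]⟩

/-- A fibre has at most `2^{n'}` points. [folklore] -/
theorem card_fib_le (x : Fin n' → Bool) : (fib Q n' x).card ≤ 2 ^ n' := by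
  refine (card_le_univ _).trans ?_
  rw [Fintype.card_fun, Fintype.card_bool, Fintype.card_fin]

/-- `0 ≤ log₂ |fibre| ≤ n'`. [folklore] -/
theorem logb_card_fib_mem (x : Fin n' → Bool) :
    0 ≤ Real.logb 2 (fib Q n' x).card ∧ Real.logb 2 (fib Q n' x).card ≤ n' := by
  have hpos : (1 : ℝ) ≤ (fib Q n' x).card := by exact_mod_cast card_fib_pos Q n' x
  refine ⟨Real.logb_nonneg (by norm_num) hpos, ?_⟩
  calc Real.logb 2 (fib Q n' x).card ≤ Real.logb 2 ((2 : ℝ) ^ n') :=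
        Real.logb_le_logb_of_le (by norm_num) (by linarith) (by exact_mod_cast card_fib_le Q n' x)
    _ = n' := by rw [Real.logb_pow, Real.logb_self_eq_one (by norm_num), mul_one]

/-- **Mean log-fibre size**: `Σ_x log₂ |fibre(x)| = 2^{n'} · (n' - H(Q(U)))`. [cite: DvirGutfreundRothblumVadhan2010, Def 2.1] -/
theorem sum_logb_card_fib :
    ∑ x : Fin n' → Bool, Real.logb 2 (fib Q n' x).card =
      (2 : ℝ) ^ n' * (n' - mapEntropy univ (evalV Q n')) := by
  have hcard : ((univ : Finset (Fin n' → Bool)).card : ℝ) = (2 : ℝ) ^ n' := by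
    rw [card_univ, Fintype.card_fun, Fintype.card_bool, Fintype.card_fin]; push_cast; ring
  have hne : (2 : ℝ) ^ n' ≠ 0 := by positivity
  unfold mapEntropy
  rw [hcard, mul_sub, mul_div_cancel₀ _ hne]
  have hterm : ∀ x : Fin n' → Bool, Real.logb 2 ((2 : ℝ) ^ n' / (fiber univ (evalV Q n') (evalV Q n' x)).card) =
      n' - Real.logb 2 (fib Q n' x).card := by
    intro x
    rw [← fib_eq_fiber, Real.logb_div hne (by exact_mod_cast (card_fib_pos Q n' x).ne'), Real.logb_pow,
      Real.logb_self_eq_one (by norm_num), mul_one]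
  rw [sum_congr rfl fun x _ => hterm x, sum_sub_distrib, sum_const, card_univ, Fintype.card_fun,
    Fintype.card_bool, Fintype.card_fin, nsmul_eq_mul]
  push_cast
  ring

end Mean

/-! ### Chebyshev for sums of independent samples -/

section Chebyshev

variable {α : Type*} [Fintype α]

/-- **Variance of an i.i.d. sum** (counting form, `T + 1` samples): for `φ` with `Σ_a φ a = 0`,
`Σ_{Y : Fin (T+1) → α} (Σᵢ φ (Y i))² = (T + 1) · |α|^T · Σ_a φ(a)²`. [Cover–Thomas, §3.1] [folklore] -/
theorem sum_sq_sum_succ_eq (φ : α → ℝ) (hφ : ∑ a, φ a = 0) :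
    ∀ T : ℕ, ∑ Y : Fin (T + 1) → α, (∑ i, φ (Y i)) ^ 2 =
      ((T : ℝ) + 1) * (Fintype.card α : ℝ) ^ T * ∑ a, φ a ^ 2
  | 0 => by
    rw [← (Equiv.funUnique (Fin 1) α).symm.sum_comp]
    simp
  | T + 1 => by
    have ih := sum_sq_sum_succ_eq φ hφ T
    rw [← (Fin.consEquiv fun _ => α).sum_comp, Fintype.sum_prod_type]
    simp only [Fin.consEquiv_apply]
    have hexp : ∀ (a : α) (Y : Fin (T + 1) → α),
        (∑ i, φ ((Fin.cons a Y : Fin (T + 2) → α) i)) ^ 2 =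
          φ a ^ 2 + φ a * (2 * ∑ i, φ (Y i)) + (∑ i, φ (Y i)) ^ 2 := by
      intro a Y
      rw [Fin.sum_univ_succ]
      simp only [Fin.cons_zero, Fin.cons_succ]
      ring
    simp only [hexp, sum_add_distrib]
    have hc : ((univ : Finset (Fin (T + 1) → α)).card : ℝ) = (Fintype.card α : ℝ) ^ (T + 1) := by
      rw [card_univ, Fintype.card_fun, Fintype.card_fin]; push_cast; ring
    have t1 : ∑ a : α, ∑ _Y : Fin (T + 1) → α, φ a ^ 2 = (Fintype.card α : ℝ) ^ (T + 1) * ∑ a, φ a ^ 2 := by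
      simp only [sum_const, nsmul_eq_mul, hc]
      rw [mul_sum]
    have t2 : ∑ a : α, ∑ Y : Fin (T + 1) → α, φ a * (2 * ∑ i, φ (Y i)) = 0 := by
      simp only [← mul_sum]
      rw [← sum_mul, hφ, zero_mul]
    have t3 : ∑ _a : α, ∑ Y : Fin (T + 1) → α, (∑ i, φ (Y i)) ^ 2 =
        (Fintype.card α : ℝ) * (((T : ℝ) + 1) * (Fintype.card α : ℝ) ^ T * ∑ a, φ a ^ 2) := by
      rw [sum_const, card_univ, nsmul_eq_mul, ih]
    rw [t1, t2, t3]
    push_cast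
    ring

/-- The same for `T` samples (both sides vanish for `T = 0`). [folklore] -/
theorem sum_sq_sum_eq (φ : α → ℝ) (hφ : ∑ a, φ a = 0) (T : ℕ) :
    ∑ Y : Fin T → α, (∑ i, φ (Y i)) ^ 2 = T * (Fintype.card α : ℝ) ^ (T - 1) * ∑ a, φ a ^ 2 := by
  cases T with
  | zero => simp
  | succ T => rw [sum_sq_sum_succ_eq φ hφ T, Nat.add_sub_cancel]; push_cast; ring

/-- **Chebyshev's inequality, counting form**: for centred `φ` and `θ > 0`, the number of tuples
with `|Σᵢ φ(Yᵢ)| ≥ θ` is at most `T |α|^{T-1} Σ_a φ(a)² / θ²`. [Cover–Thomas, §3.1 (AEP)] [folklore] -/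
theorem card_filter_devi_le (φ : α → ℝ) (hφ : ∑ a, φ a = 0) (T : ℕ) {θ : ℝ} (hθ : 0 < θ)
    (s : Finset (Fin T → α)) (hs : ∀ Y ∈ s, θ ≤ |∑ i, φ (Y i)|) :
    (s.card : ℝ) ≤ T * (Fintype.card α : ℝ) ^ (T - 1) * (∑ a, φ a ^ 2) / θ ^ 2 := by
  rw [le_div_iff₀ (by positivity), ← sum_sq_sum_eq φ hφ T]
  have h1 : (s.card : ℝ) * θ ^ 2 = ∑ _Y ∈ s, θ ^ 2 := by rw [sum_const, nsmul_eq_mul]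
  have h2 : ∑ _Y ∈ s, θ ^ 2 ≤ ∑ Y ∈ s, (∑ i, φ (Y i)) ^ 2 := by
    refine sum_le_sum fun Y hY => ?_
    rw [← sq_abs (∑ i, φ (Y i))]
    exact pow_le_pow_left₀ hθ.le (hs Y hY) 2
  have h3 : ∑ Y ∈ s, (∑ i, φ (Y i)) ^ 2 ≤ ∑ Y : Fin T → α, (∑ i, φ (Y i)) ^ 2 :=
    sum_le_sum_of_subset_of_nonneg (subset_univ s) fun Y _ _ => sq_nonneg _
  linarith

end Chebyshev

/-! ### Typical sample tuples -/

section Typical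

variable (Q : List (List (List ℕ))) (n' : ℕ)

/-- The sum of the log-fibre sizes of the `T = 128 n'²` samples is within `T/4` of `T(n' - H)` for all
but at most an eighth of the sample tuples `Y ∈ (F₂^{n'})ᵀ` (Chebyshev with `log₂|fibre| ∈ [0, n']`).
[Cover–Thomas, §3.1] [cite: Sipser1983, §V] -/
theorem card_far_logfib_le (hn : 1 ≤ n') :
    8 * ((univ : Finset (Fin (pT n') → (Fin n' → Bool))).filter fun Y =>
        (pT n' : ℝ) / 4 ≤ |∑ i, Real.logb 2 (fib Q n' (Y i)).card -
          (pT n' : ℝ) * (n' - mapEntropy univ (evalV Q n'))|).card ≤ 2 ^ (n' * pT n') := by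
  classical
  set T := pT n' with hT
  set Hq := mapEntropy univ (evalV Q n') with hHq
  set μ : ℝ := n' - Hq with hμ
  -- centre the log-fibre size
  set φ : (Fin n' → Bool) → ℝ := fun x => Real.logb 2 (fib Q n' x).card - μ with hφ
  have hcardα : (Fintype.card (Fin n' → Bool) : ℝ) = (2 : ℝ) ^ n' := by
    rw [Fintype.card_fun, Fintype.card_bool, Fintype.card_fin]; push_cast; ring
  have hφ0 : ∑ x, φ x = 0 := by
    simp only [hφ, sum_sub_distrib, sum_logb_card_fib, sum_const, card_univ, nsmul_eq_mul, hcardα, hμ]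
    ring
  have hφsq : ∑ x, φ x ^ 2 ≤ (2 : ℝ) ^ n' * (n' : ℝ) ^ 2 := by
    have hμ0 : 0 ≤ μ := by
      have hle := mapEntropy_le_logb_card (univ : Finset (Fin n' → Bool)) (evalV Q n')
      rw [card_univ, hcardα, Real.logb_pow, Real.logb_self_eq_one (by norm_num), mul_one] at hle
      simp only [hμ, hHq]; linarith
    have hμn : μ ≤ n' := by
      have := mapEntropy_nonneg (univ : Finset (Fin n' → Bool)) (evalV Q n')
      simp only [hμ, hHq] at this ⊢; linarith
    have hb : ∀ x, φ x ^ 2 ≤ (n' : ℝ) ^ 2 := by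
      intro x
      have h1 := logb_card_fib_mem Q n' x
      have hφx : φ x = Real.logb 2 (fib Q n' x).card - μ := rfl
      rw [hφx]
      exact sq_le_sq' (by linarith [h1.1, h1.2]) (by linarith [h1.1, h1.2])
    calc ∑ x, φ x ^ 2 ≤ ∑ _x : Fin n' → Bool, (n' : ℝ) ^ 2 := sum_le_sum fun x _ => hb x
      _ = (2 : ℝ) ^ n' * (n' : ℝ) ^ 2 := by rw [sum_const, card_univ, nsmul_eq_mul, hcardα]
  -- rewrite the event through `φ`
  have hev : ∀ Y : Fin T → (Fin n' → Bool), ∑ i, Real.logb 2 (fib Q n' (Y i)).card - (T : ℝ) * (n' - Hq) =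
      ∑ i, φ (Y i) := by
    intro Y
    simp only [hφ, sum_sub_distrib, sum_const, card_univ, Fintype.card_fin, nsmul_eq_mul, hμ]
    ring
  have hTpos : (0 : ℝ) < T := by
    have : 1 ≤ T := by rw [hT, pT]; nlinarith
    exact_mod_cast this
  have hcheb := card_filter_devi_le φ hφ0 T (θ := (T : ℝ) / 4) (by positivity)
    ((univ : Finset (Fin T → (Fin n' → Bool))).filter fun Y =>
        (T : ℝ) / 4 ≤ |∑ i, Real.logb 2 (fib Q n' (Y i)).card - (T : ℝ) * (n' - Hq)|)
    (fun Y hY => by rw [← hev Y]; exact (mem_filter.1 hY).2)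
  -- arithmetic: `T |α|^{T-1} (2^{n'} n'²) / (T/4)² = 16 n'² 2^{n' T} / T = 2^{n'T} / 8`
  have hT1 : 1 ≤ T := by rw [hT, pT]; nlinarith
  have hpow : (Fintype.card (Fin n' → Bool) : ℝ) ^ (T - 1) * (2 : ℝ) ^ n' = (2 : ℝ) ^ (n' * T) := by
    rw [hcardα, ← pow_mul, ← pow_add]
    congr 1
    obtain ⟨T', hT'⟩ : ∃ T', T = T' + 1 := ⟨T - 1, by omega⟩
    rw [hT']; simp; ring
  have key : (((univ : Finset (Fin T → (Fin n' → Bool))).filter fun Y =>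
        (T : ℝ) / 4 ≤ |∑ i, Real.logb 2 (fib Q n' (Y i)).card - (T : ℝ) * (n' - Hq)|).card : ℝ) ≤
      (2 : ℝ) ^ (n' * T) / 8 := by
    refine hcheb.trans ?_
    rw [div_le_div_iff₀ (by positivity) (by norm_num)]
    have hTT : (T : ℝ) = 128 * (n' : ℝ) ^ 2 := by rw [hT, pT]; push_cast; ring
    calc T * (Fintype.card (Fin n' → Bool) : ℝ) ^ (T - 1) * (∑ a, φ a ^ 2) * 8
        ≤ T * (Fintype.card (Fin n' → Bool) : ℝ) ^ (T - 1) * ((2 : ℝ) ^ n' * (n' : ℝ) ^ 2) * 8 := by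
          gcongr
      _ = (2 : ℝ) ^ (n' * T) * (8 * T * (n' : ℝ) ^ 2) := by rw [← hpow]; ring
      _ = (2 : ℝ) ^ (n' * T) * ((T : ℝ) / 4) ^ 2 := by rw [hTT]; ring
  have : ((8 * ((univ : Finset (Fin T → (Fin n' → Bool))).filter fun Y =>
        (T : ℝ) / 4 ≤ |∑ i, Real.logb 2 (fib Q n' (Y i)).card - (T : ℝ) * (n' - Hq)|).card : ℕ) : ℝ) ≤
      ((2 ^ (n' * T) : ℕ) : ℝ) := by
    push_cast; linarith
  exact_mod_cast this

end Typical

end PEAHash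

end Literature.Computability.Complexity
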